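import Summits.QuantumFields.YangMills.Theorems.BalabanUVNodesN15KingModelSlicesTwoSpacingBridges
import HarnessLib

/-!
# BalabanUVNodes ∕ N15 — THE KING-MODEL RUNG, CURVED EDITION (PART Χ-b): KING 1986 PROPOSITION 3.9, THE SUP LINES (3.73) **AT `A = 0`** FOR THE DATUM
# `kingSlicesTwoSpacing` (part Χ-a) — the two-spacing η-RATE of King's genuine slices `|G^{η′}_{(j)}(x′, y′) − G^η_{(j)}(x, y)|`,
# `|∂^{η′}_μG^{η′}_{(j)}(x′, y′) − ∂^η_μG^η_{(j)}(x, y)| ≤ C·L^{−γk}·{(L^jη)^{2−D−γ}, (L^jη)^{1−D−γ}}·e^{−δ₀(L^jη)^{−1}|x − y|}`, `0 ≤ j ≤ k − 1`, ONE `(C, δ₀)` per rate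
# `0 < γ < ½`, UNIFORM in `k ≥ 1`, `n ≥ 1`, the cube `2L^{e_M}` and the mass `0 < m² ≤ m₀²`; (3.74) EMPTY BY TYPE
# (Track A, DAG node N15 = NE2; FAN-OUT v1.1 §N15 s3 «KING-MODEL RUNG … NE2's analogue DECIDED in the model»)

HONEST FRAMING.  Count-neutral (cell `pub-ymgap`, seat `pub-ymgap-dag-n15-e` g18; `--supports stmt-QuantumFields-27366 --as helper` = K3⁸
`SpineGivenEndpointR13SepCoPHV`).  TEMPLATE LITERATURE, `A = 0`: C. King's scalar U(1)-Higgs MODEL on finite tori ([King1986] Prop. 3.9 (3.73) p. 665 —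
PRINTED and proved there, §4 (4.42)–(4.43) p. 675: *"we can telescope the difference and use Proposition 3.8, and Lemma 4.5 … When j = 0, we bound each term
separately using Proposition 3.7"*; here DECIDED for the tree's objects at `A = 0`, `Ω = T_η`), NOT Bałaban's covariant objects; NE2⁺ is NOT PRINTED for
those and not proved; NOT a node discharge; nothing continuum ∕ ℝ⁴ ∕ OS ∕ mass-gap ∕ Clay.  0 `sorry`, 0 `def`; standard axioms.

THE TWO-SPACING RATE IS THE TREE's: part M `ksSlice_rate_unif` ((4.43) on the torus, mass-uniform: `|ksSlice′(x′, y′) − ksSlice(x, y)| ≤ C(L^{−γ₀∕2})^j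
e^{−δ|B_j(x) − B_j(y)|_U}`) and part M′ `ksDSlice_rate_unif` (one differentiated leg), read through part Χ-a's bridges (`kingSliceG_hi_eq`∕`_lo_eq`,
`kingSliceDG_hi_eq`∕`_lo_eq`, `kingSlicePt_bridge`) and part Ρ-a's `exp_sliceBlockDist_le` (block decay ⇒ decay on the slice length); King's rate letter
`L^{−γk}(L^jη)^{−γ} = L^{−γj}` is §1's `schemaRate_eq` (part G's `slice_rate_identity` on this carrier).  For `j = 0` the two members are bounded SEPARATELY by
part Ρ-e₂'s (3.63) letters (`kingSliceKernels_ineq363_pos` for the fine run's slice `n`, `_zero` for `C^{(0),η}`): the rate letter is `1` there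
(`L^{−γk}η^{−γ} = 1`), exactly as King says.  The pairing moves weights by one coarse spacing (Χ-a `dist_kingSlicePt_le`: a factor `e^{δ₀}`).
MAIN RESULTS: §2 `kingSlicesTwoSpacing_ineq373_pos` (`1 ≤ j < k`), §3 `kingSlicesTwoSpacing_ineq373_zero` (`j = 0`), §4 ★★ `kingSlicesTwoSpacing_ineq373`
(all `j + 1 ≤ k`, in the letters of `SlicePropagator.Prop39PrintedAt`: `T.hi.G`, `T.lo.G`, `T.pt`, `T.lo.slice`, `T.lo.dist`).  The Hölder lines (3.75) and
the by-name theorem `Prop39KingOrder (kingSlicesTwoSpacing …)` are parts Χ-c∕Χ-d.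
HONEST SCOPE: `A = 0`, periodic b.c., odd `L ≥ 3`, `k, n ≥ 1`, cube `2L^{e_M}`, `0 < m² ≤ m₀²`; rate exponents `0 < γ < ½` (King: «γ sufficiently small»);
the (2.20)∕(2.17) dictionary APPLIED as the definition of the level-`k` kernels (part Ρ-e∕Χ-a); (3.74) is about the VECTOR field's contour kernels — empty
by type here.  WHAT THE CURVED CASE ADDS (one line): (3.73)–(3.74) for `G_(j)(Ω, A)`, regular `A ≠ 0`, `Ω ⊊ T_η` — [King1986] §4, not in the model.
Locators: [King1986] (2.17) p.653, (2.20) p.654, Prop. 3.7 (3.63) p.663, p.664 (pairing), Prop. 3.9 (3.73)–(3.74) p.665, (4.42)–(4.43) p.675.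
-/

noncomputable section

namespace Summit.QuantumFields.YangMills.BalabanUVNodes.N15KingModelRung.Curved

open Real Finset Matrix
open Literature.MathematicalPhysics.QuantumFieldTheory.Balaban1983to89.B5Prop11Plancherel (Tor fine unitVec)
open Literature.MathematicalPhysics.QuantumFieldTheory.King1986.Torus (blockOf tdistT tdistT_nonneg torCongr tdistT_torCongr)
open Literature.MathematicalPhysics.QuantumFieldTheory.King1986.SlicePropagator (SliceKernels TwoSpacing holderDeriv)

variable {d : ℕ} (L : ℕ) [NeZero L]

/-! ## §1 King's rate letter on the one carrier, and the weights -/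

section Letters

/-- ★ **KING's RATE LETTER**: `L^{−γk}·(L^j∕L^k)^{e−γ} = (L^j∕L^k)^{e}·(L^{−γ})^j` — the printed `CL^{−γk}(L^jη)^{2−d−γ}` of (3.73) is the slice's size
`(L^jη)^{2−d}` times the rate `L^{−γj}` of the `j` levels below it (part G `slice_rate_identity`, here on the one carrier). [cite: King1986, Prop. 3.9 (3.73) p.665, (4.43) p.675] -/
theorem schemaRate_eq (γ e : ℝ) (j k : ℕ) :
    (L : ℝ) ^ (-(γ * k)) * ((L : ℝ) ^ j / (L : ℝ) ^ k) ^ (e - γ) = ((L : ℝ) ^ j / (L : ℝ) ^ k) ^ e * ((L : ℝ) ^ (-γ)) ^ j := by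
  have hL0 : (0 : ℝ) < L := by exact_mod_cast Nat.pos_of_ne_zero (NeZero.ne L)
  have hj : (0 : ℝ) < (L : ℝ) ^ j := pow_pos hL0 _
  have hk : (0 : ℝ) < (L : ℝ) ^ k := pow_pos hL0 _
  have hs : (0 : ℝ) < (L : ℝ) ^ j / (L : ℝ) ^ k := div_pos hj hk
  have h1 : (L : ℝ) ^ (-(γ * k)) = ((L : ℝ) ^ k) ^ (-γ) := by
    rw [show (-(γ * k) : ℝ) = (k : ℝ) * (-γ) by ring, Real.rpow_natCast_mul hL0.le]
  have h2 : ((L : ℝ) ^ j / (L : ℝ) ^ k) ^ (e - γ) = ((L : ℝ) ^ j / (L : ℝ) ^ k) ^ e * (((L : ℝ) ^ j) ^ (-γ) / ((L : ℝ) ^ k) ^ (-γ)) := by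
    rw [sub_eq_add_neg, Real.rpow_add hs, Real.div_rpow hj.le hk.le (-γ)]
  have h3 : ((L : ℝ) ^ (-γ)) ^ j = ((L : ℝ) ^ j) ^ (-γ) := by
    rw [← Real.rpow_mul_natCast hL0.le, ← Real.rpow_natCast_mul hL0.le, mul_comm]
  have hk0 : ((L : ℝ) ^ k) ^ (-γ) ≠ 0 := (Real.rpow_pos_of_pos hk _).ne'
  rw [h1, h2, h3]
  field_simp

/-- The rate letter is at most one: `(L^{−γ})^j ≤ 1` for `γ ≥ 0`, `L ≥ 1`. [folklore] -/
theorem ratePow_le_one {γ : ℝ} (hγ : 0 ≤ γ) (j : ℕ) : ((L : ℝ) ^ (-γ)) ^ j ≤ 1 := by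
  have hL1 : (1 : ℝ) ≤ L := by exact_mod_cast Nat.one_le_iff_ne_zero.mpr (NeZero.ne L)
  exact pow_le_one₀ (Real.rpow_nonneg (by linarith) _) (Real.rpow_le_one_of_one_le_of_nonpos hL1 (by linarith))

omit [NeZero L] in
/-- The two spellings of the rate base: `L^{−(2γ)∕2} = L^{−γ}`. [folklore] -/
theorem rpow_neg_two_mul_div_two (γ : ℝ) : (L : ℝ) ^ (-(2 * γ / 2)) = (L : ℝ) ^ (-γ) := by
  congr 1; ring

/-- The slice ratio is at most one for `j ≤ k` (`L ≥ 1`). [folklore] -/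
theorem sliceRatio_le_one {j k : ℕ} (hjk : j ≤ k) : (L : ℝ) ^ j / (L : ℝ) ^ k ≤ 1 := by
  have hL0 : (0 : ℝ) < L := by exact_mod_cast Nat.pos_of_ne_zero (NeZero.ne L)
  have hL1 : (1 : ℝ) ≤ L := by exact_mod_cast Nat.one_le_iff_ne_zero.mpr (NeZero.ne L)
  rw [div_le_one (pow_pos hL0 _)]
  exact pow_le_pow_right₀ hL1 hjk

/-- The masses of the slices stay in the window: `0 < m²(L^j∕L^k)² ≤ m₀²` for `0 < m² ≤ m₀²`, `j ≤ k`. [cite: King1986, (2.20) p.654] -/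
theorem sliceMass_window {j k : ℕ} (hjk : j ≤ k) {msq m0sq : ℝ} (hm : 0 < msq) (hcap : msq ≤ m0sq) :
    0 < msq * ((L : ℝ) ^ j / (L : ℝ) ^ k) ^ 2 ∧ msq * ((L : ℝ) ^ j / (L : ℝ) ^ k) ^ 2 ≤ m0sq := by
  have hL0 : (0 : ℝ) < L := by exact_mod_cast Nat.pos_of_ne_zero (NeZero.ne L)
  have hs : (0 : ℝ) < (L : ℝ) ^ j / (L : ℝ) ^ k := div_pos (pow_pos hL0 _) (pow_pos hL0 _)
  have hs1 : ((L : ℝ) ^ j / (L : ℝ) ^ k) ^ 2 ≤ 1 := pow_le_one₀ hs.le (sliceRatio_le_one L hjk)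
  exact ⟨by positivity, (mul_le_of_le_one_right hm.le hs1).trans hcap⟩

/-- The schema's exponential at slice `j` in the one carrier's currency: `δ·(L^j∕L^k)⁻¹·(t∕L^k) = δ·(t∕L^j)` (part Ρ-e `sliceWeight_eq`, restated with the
factors grouped as in `Prop39PrintedAt`). [folklore] -/
theorem schemaWeight_eq (δ t : ℝ) (j k : ℕ) :
    Real.exp (-(δ * ((L : ℝ) ^ j / (L : ℝ) ^ k)⁻¹ * (t / (L : ℝ) ^ k))) = Real.exp (-(δ * (t / (L : ℝ) ^ j))) := by
  have hL0 : (0 : ℝ) < L := by exact_mod_cast Nat.pos_of_ne_zero (NeZero.ne L)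
  rw [sliceWeight_eq hL0]

end Letters

/-! ## §2 (3.73) for the slices `1 ≤ j ≤ k − 1`: the two-spacing rate of parts M∕M′ -/

section Pos

/-- ★★ **(3.73), BOTH LINES, FOR `1 ≤ j ≤ k − 1`** (one carrier's currency): for odd `L ≥ 3`, `a > 0`, `m₀² ≥ 0` and a rate `0 < γ < ½` there are `C, δ₀ > 0` such
that for EVERY `k, n ≥ 1`, cube `2L^{e_M}`, mass `0 < m² ≤ m₀²`, slice `1 ≤ j < k` and fine points `x′, y′` over `x, y`:
`|G^{η′}_{(j)}(x′, y′) − G^η_{(j)}(x, y)| ≤ C·L^{−γk}(L^j∕L^k)^{2−D−γ}·e^{−δ₀(L^j∕L^k)^{−1}|x − y|∕L^k}` and the same for the gradients with `(L^j∕L^k)^{1−D−γ}`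
(parts M∕M′ at the rate `2γ`, through Χ-a's bridges). [cite: King1986, Prop. 3.9 (3.73) p.665, (4.42)–(4.43) p.675] -/
theorem kingSlicesTwoSpacing_ineq373_pos (hLodd : Odd L) (hL : 2 ≤ L) {a : ℝ} (ha : 0 < a) {m0sq : ℝ} (hm0 : 0 ≤ m0sq) {γ : ℝ}
    (hγ0 : 0 < γ) (hγ1 : γ < 1 / 2) :
    ∃ C δ₀ : ℝ, 0 < C ∧ 0 < δ₀ ∧
    ∀ (k n eM : ℕ) (hk : 1 ≤ k) (hn : 1 ≤ n) (M : Fin (d + 1) → ℕ) [∀ μ, NeZero (M μ)] (hM : ∀ μ, M μ = 2 * L ^ eM)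
      (msq : ℝ), 0 < msq → msq ≤ m0sq → ∀ (j : ℕ), 1 ≤ j → j < k → ∀ x' y' : Tor (fine (L ^ (k + n)) M),
      |(kingSlicesTwoSpacing L k n eM M hM hk a msq).hi.G j x' y'
          - kingSliceG L k eM M hM hk a msq j (kingSlicePt L k n M x') (kingSlicePt L k n M y')|
        ≤ C * (L : ℝ) ^ (-(γ * k)) * ((L : ℝ) ^ j / (L : ℝ) ^ k) ^ ((2 : ℝ) - (d + 1 : ℕ) - γ)
            * Real.exp (-(δ₀ * (tdistT (fine (L ^ k) M) (kingSlicePt L k n M x') (kingSlicePt L k n M y') / (L : ℝ) ^ j))) ∧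
      ∀ μ : Fin (d + 1),
        |(kingSlicesTwoSpacing L k n eM M hM hk a msq).hi.dG j μ x' y'
            - (kingSliceKernels L k eM M hM hk a msq).dG j μ (kingSlicePt L k n M x') (kingSlicePt L k n M y')|
          ≤ C * (L : ℝ) ^ (-(γ * k)) * ((L : ℝ) ^ j / (L : ℝ) ^ k) ^ ((1 : ℝ) - (d + 1 : ℕ) - γ)
              * Real.exp (-(δ₀ * (tdistT (fine (L ^ k) M) (kingSlicePt L k n M x') (kingSlicePt L k n M y') / (L : ℝ) ^ j))) := by
  have h2γ0 : 0 ≤ 2 * γ := by linarith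
  have h2γ1 : 2 * γ < 1 := by linarith
  obtain ⟨C₁, δ₁, hC₁, hδ₁, H₁⟩ := ksSlice_rate_unif (d := d) L hLodd hL ha hm0 h2γ0 h2γ1.le
  obtain ⟨C₂, δ₂, hC₂, hδ₂, H₂⟩ := ksDSlice_rate_unif (d := d) L hLodd hL ha hm0 h2γ0 h2γ1
  have hL0 : (0 : ℝ) < L := by exact_mod_cast Nat.pos_of_ne_zero (NeZero.ne L)
  set δ₀ : ℝ := min δ₁ δ₂ with hδdef
  have hδ₀ : 0 < δ₀ := lt_min hδ₁ hδ₂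
  set C : ℝ := (C₁ + C₂) * Real.exp δ₀ with hCdef
  have hC : 0 < C := by positivity
  refine ⟨C, δ₀, hC, hδ₀, ?_⟩
  intro k n eM hk hn M _ hM msq hmsq hcap j hj hjk x' y'
  -- the two-spacing index, its carriers, the paired points
  set i : KSliceIdx d := kingSliceIdx₂ k eM j n hj hn with hidef
  have chi := kingSliceIdx₂_carrier_hi (d := d) M hM hj hjk hn
  have clo := kingSliceIdx₂_carrier_lo (d := d) M hM hj hjk hn
  set X' := torCongr (kingSliceIdx₂_carrier_hi (d := d) M hM hj hjk hn) x' with hX'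
  set Y' := torCongr (kingSliceIdx₂_carrier_hi (d := d) M hM hj hjk hn) y' with hY'
  have hbx := kingSlicePt_bridge (d := d) M hM hj hjk hn x'
  have hby := kingSlicePt_bridge (d := d) M hM hj hjk hn y'
  -- masses, ratio, weights
  obtain ⟨hms, hmscap⟩ := sliceMass_window L hjk.le hmsq hcap
  have hs : (0 : ℝ) < (L : ℝ) ^ j / (L : ℝ) ^ k := div_pos (pow_pos hL0 _) (pow_pos hL0 _)
  have hrate := rpow_neg_two_mul_div_two L γ
  -- the block weight at the paired points ≤ e^{δ₀}·(the fine weight on the slice length)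
  have hW : ∀ {δ : ℝ}, δ₀ ≤ δ →
      Real.exp (-(δ * tdistT (ksU L i) (blockOf (L ^ i.j) (ksU L i) (underPtN L i.j i.n (ksU L i) X'))
          (blockOf (L ^ i.j) (ksU L i) (underPtN L i.j i.n (ksU L i) Y'))))
        ≤ Real.exp δ₀ * Real.exp (-(δ₀ * (tdistT (fine (L ^ k) M) (kingSlicePt L k n M x') (kingSlicePt L k n M y') / (L : ℝ) ^ j))) := by
    intro δ hδ
    rw [hX', hY', ← hbx, ← hby]
    refine le_trans (Real.exp_le_exp.mpr ?_) (exp_sliceBlockDist_le L i M clo hδ₀.le (kingSlicePt L k n M x') (kingSlicePt L k n M y'))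
    have := tdistT_nonneg (ksU L i) (blockOf (L ^ i.j) (ksU L i) (torCongr clo (kingSlicePt L k n M x')))
      (blockOf (L ^ i.j) (ksU L i) (torCongr clo (kingSlicePt L k n M y')))
    nlinarith
  refine ⟨?_, fun μ => ?_⟩
  · -- line 1
    rw [kingSlicesTwoSpacing_hiG, kingSliceG_hi_eq M hM hk a msq hj hjk hn, kingSliceG_lo_eq M hM hk a msq hj hjk hn, hbx, hby, ← mul_sub,
      abs_mul, abs_of_pos (Real.rpow_pos_of_pos hs _), mul_assoc C, schemaRate_eq, ← hrate]
    have h := H₁ _ hms hmscap i X' Y'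
    calc ((L : ℝ) ^ j / (L : ℝ) ^ k) ^ ((2 : ℝ) - (d + 1 : ℕ)) * |ksSlice' L a (msq * ((L : ℝ) ^ j / (L : ℝ) ^ k) ^ 2) i X' Y'
            - ksSlice L a (msq * ((L : ℝ) ^ j / (L : ℝ) ^ k) ^ 2) i (underPtN L i.j i.n (ksU L i) X') (underPtN L i.j i.n (ksU L i) Y')|
        ≤ ((L : ℝ) ^ j / (L : ℝ) ^ k) ^ ((2 : ℝ) - (d + 1 : ℕ)) * (C₁ * ((L : ℝ) ^ (-(2 * γ / 2))) ^ i.j * (Real.exp δ₀ *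
            Real.exp (-(δ₀ * (tdistT (fine (L ^ k) M) (kingSlicePt L k n M x') (kingSlicePt L k n M y') / (L : ℝ) ^ j))))) := by
          refine mul_le_mul_of_nonneg_left (h.trans ?_) (Real.rpow_nonneg hs.le _)
          exact mul_le_mul_of_nonneg_left (hW (min_le_left _ _)) (by positivity)
      _ = (C₁ * Real.exp δ₀) * (((L : ℝ) ^ j / (L : ℝ) ^ k) ^ ((2 : ℝ) - (d + 1 : ℕ)) * ((L : ℝ) ^ (-(2 * γ / 2))) ^ j *
            Real.exp (-(δ₀ * (tdistT (fine (L ^ k) M) (kingSlicePt L k n M x') (kingSlicePt L k n M y') / (L : ℝ) ^ j)))) := by ring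
      _ ≤ C * (((L : ℝ) ^ j / (L : ℝ) ^ k) ^ ((2 : ℝ) - (d + 1 : ℕ)) * ((L : ℝ) ^ (-(2 * γ / 2))) ^ j *
            Real.exp (-(δ₀ * (tdistT (fine (L ^ k) M) (kingSlicePt L k n M x') (kingSlicePt L k n M y') / (L : ℝ) ^ j)))) := by
          have hθ : 0 ≤ ((L : ℝ) ^ (-(2 * γ / 2))) ^ j := pow_nonneg (Real.rpow_nonneg hL0.le _) _
          have hE := Real.exp_nonneg (-(δ₀ * (tdistT (fine (L ^ k) M) (kingSlicePt L k n M x') (kingSlicePt L k n M y') / (L : ℝ) ^ j)))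
          have hC1 : C₁ * Real.exp δ₀ ≤ C := by rw [hCdef]; nlinarith [Real.exp_pos δ₀]
          exact mul_le_mul_of_nonneg_right hC1 (mul_nonneg (mul_nonneg (Real.rpow_nonneg hs.le _) hθ) hE)
      _ = C * (((L : ℝ) ^ j / (L : ℝ) ^ k) ^ ((2 : ℝ) - (d + 1 : ℕ)) * ((L : ℝ) ^ (-(2 * γ / 2))) ^ j) *
            Real.exp (-(δ₀ * (tdistT (fine (L ^ k) M) (kingSlicePt L k n M x') (kingSlicePt L k n M y') / (L : ℝ) ^ j))) := by ring
  · -- line 2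
    rw [kingSliceDG_hi_eq M hM hk a msq hj hjk hn, kingSliceDG_lo_eq M hM hk a msq hj hjk hn, hbx, hby, ← mul_sub,
      abs_mul, abs_of_pos (Real.rpow_pos_of_pos hs _), mul_assoc C, schemaRate_eq, ← hrate]
    have h := H₂ _ hms hmscap i μ X' Y'
    calc ((L : ℝ) ^ j / (L : ℝ) ^ k) ^ ((1 : ℝ) - (d + 1 : ℕ)) * |ksDSlice' L a (msq * ((L : ℝ) ^ j / (L : ℝ) ^ k) ^ 2) i μ X' Y'
            - ksDSlice L a (msq * ((L : ℝ) ^ j / (L : ℝ) ^ k) ^ 2) i μ (underPtN L i.j i.n (ksU L i) X') (underPtN L i.j i.n (ksU L i) Y')|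
        ≤ ((L : ℝ) ^ j / (L : ℝ) ^ k) ^ ((1 : ℝ) - (d + 1 : ℕ)) * (C₂ * ((L : ℝ) ^ (-(2 * γ / 2))) ^ i.j * (Real.exp δ₀ *
            Real.exp (-(δ₀ * (tdistT (fine (L ^ k) M) (kingSlicePt L k n M x') (kingSlicePt L k n M y') / (L : ℝ) ^ j))))) := by
          refine mul_le_mul_of_nonneg_left (h.trans ?_) (Real.rpow_nonneg hs.le _)
          exact mul_le_mul_of_nonneg_left (hW (min_le_right _ _)) (by positivity)
      _ = (C₂ * Real.exp δ₀) * (((L : ℝ) ^ j / (L : ℝ) ^ k) ^ ((1 : ℝ) - (d + 1 : ℕ)) * ((L : ℝ) ^ (-(2 * γ / 2))) ^ j *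
            Real.exp (-(δ₀ * (tdistT (fine (L ^ k) M) (kingSlicePt L k n M x') (kingSlicePt L k n M y') / (L : ℝ) ^ j)))) := by ring
      _ ≤ C * (((L : ℝ) ^ j / (L : ℝ) ^ k) ^ ((1 : ℝ) - (d + 1 : ℕ)) * ((L : ℝ) ^ (-(2 * γ / 2))) ^ j *
            Real.exp (-(δ₀ * (tdistT (fine (L ^ k) M) (kingSlicePt L k n M x') (kingSlicePt L k n M y') / (L : ℝ) ^ j)))) := by
          have hθ : 0 ≤ ((L : ℝ) ^ (-(2 * γ / 2))) ^ j := pow_nonneg (Real.rpow_nonneg hL0.le _) _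
          have hE := Real.exp_nonneg (-(δ₀ * (tdistT (fine (L ^ k) M) (kingSlicePt L k n M x') (kingSlicePt L k n M y') / (L : ℝ) ^ j)))
          have hC2 : C₂ * Real.exp δ₀ ≤ C := by rw [hCdef]; nlinarith [Real.exp_pos δ₀]
          exact mul_le_mul_of_nonneg_right hC2 (mul_nonneg (mul_nonneg (Real.rpow_nonneg hs.le _) hθ) hE)
      _ = C * (((L : ℝ) ^ j / (L : ℝ) ^ k) ^ ((1 : ℝ) - (d + 1 : ℕ)) * ((L : ℝ) ^ (-(2 * γ / 2))) ^ j) *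
            Real.exp (-(δ₀ * (tdistT (fine (L ^ k) M) (kingSlicePt L k n M x') (kingSlicePt L k n M y') / (L : ℝ) ^ j))) := by ring

end Pos

/-! ## §3 (3.73) for the finest slice `j = 0`: both members separately, by Proposition 3.7 -/

section Zero

/-- The pairing moves the unit-scale weight by at most one: `e^{−δ·L^k·|x′ − y′|∕L^{k+n}} ≤ e^{δ}·e^{−δ|x − y|}` (`δ ≥ 0`; Χ-a `mul_tdistT_kingSlicePt_le`).
[cite: King1986, p.664 (pairing)] -/
theorem exp_hiWeight_zero_le {δ : ℝ} (hδ : 0 ≤ δ) (k n : ℕ) (M : Fin (d + 1) → ℕ) [∀ μ, NeZero (M μ)] (x' y' : Tor (fine (L ^ (k + n)) M)) :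
    Real.exp (-(δ * ((L : ℝ) ^ 0 / (L : ℝ) ^ k)⁻¹ * (tdistT (fine (L ^ (k + n)) M) x' y' / (L : ℝ) ^ (k + n))))
      ≤ Real.exp δ * Real.exp (-(δ * (tdistT (fine (L ^ k) M) (kingSlicePt L k n M x') (kingSlicePt L k n M y') / (L : ℝ) ^ 0))) := by
  have hL0 : (0 : ℝ) < L := by exact_mod_cast Nat.pos_of_ne_zero (NeZero.ne L)
  have hk : (0 : ℝ) < (L : ℝ) ^ k := pow_pos hL0 _
  have hn : (0 : ℝ) < (L : ℝ) ^ n := pow_pos hL0 _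
  have hn1 : (1 : ℝ) ≤ (L : ℝ) ^ n := one_le_pow₀ (by exact_mod_cast Nat.one_le_iff_ne_zero.mpr (NeZero.ne L))
  have h := mul_tdistT_kingSlicePt_le L k n M x' y'
  push_cast at h
  -- `L^k·t′∕L^{k+n} = t′∕L^n ≥ t − 1 + 1∕L^n ≥ t − 1`
  have hid : ((L : ℝ) ^ 0 / (L : ℝ) ^ k)⁻¹ * (tdistT (fine (L ^ (k + n)) M) x' y' / (L : ℝ) ^ (k + n))
      = tdistT (fine (L ^ (k + n)) M) x' y' / (L : ℝ) ^ n := by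
    rw [pow_zero, pow_add (L : ℝ) k n]; field_simp
  have hge : tdistT (fine (L ^ k) M) (kingSlicePt L k n M x') (kingSlicePt L k n M y') - 1
      ≤ tdistT (fine (L ^ (k + n)) M) x' y' / (L : ℝ) ^ n := by
    rw [le_div_iff₀ hn]
    have := tdistT_nonneg (fine (L ^ k) M) (kingSlicePt L k n M x') (kingSlicePt L k n M y')
    nlinarith
  rw [mul_assoc, hid, pow_zero, div_one, ← Real.exp_add]
  exact Real.exp_le_exp.mpr (by nlinarith)

/-- ★★ **(3.73), BOTH LINES, FOR `j = 0`**: *"When j = 0, we bound each term separately using Proposition 3.7"* (p. 675) — the fine member is the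
`(k+n)`-run's slice `n` (part Ρ-e₂ `kingSliceKernels_ineq363_pos`, length `L^nη′ = η`), the coarse member is `C^{(0),η}` (`kingSliceKernels_ineq363_zero`);
the rate letter `L^{−γk}η^{−γ}` is `1`, so the display holds at EVERY `γ`: for odd `L ≥ 3`, `a > 0`, `m₀² ≥ 0` there are `C, δ₀ > 0` with
`|G^{η′}_{(0)}(x′, y′) − G^η_{(0)}(x, y)| ≤ C·L^{−γk}(1∕L^k)^{2−D−γ}·e^{−δ₀|x − y|}` and the gradient twin, for every `γ`, `k, n ≥ 1`, cube, mass and points.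
[cite: King1986, Prop. 3.9 (3.73) p.665, (4.42) p.675 («When j = 0 …»), Prop. 3.7 (3.63) p.663] -/
theorem kingSlicesTwoSpacing_ineq373_zero (hLodd : Odd L) (hL : 2 ≤ L) {a : ℝ} (ha : 0 < a) {m0sq : ℝ} (hm0 : 0 ≤ m0sq) :
    ∃ C δ₀ : ℝ, 0 < C ∧ 0 < δ₀ ∧
    ∀ (γ : ℝ) (k n eM : ℕ) (hk : 1 ≤ k) (_hn : 1 ≤ n) (M : Fin (d + 1) → ℕ) [∀ μ, NeZero (M μ)] (hM : ∀ μ, M μ = 2 * L ^ eM)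
      (msq : ℝ), 0 < msq → msq ≤ m0sq → ∀ x' y' : Tor (fine (L ^ (k + n)) M),
      |(kingSlicesTwoSpacing L k n eM M hM hk a msq).hi.G 0 x' y'
          - kingSliceG L k eM M hM hk a msq 0 (kingSlicePt L k n M x') (kingSlicePt L k n M y')|
        ≤ C * (L : ℝ) ^ (-(γ * k)) * ((L : ℝ) ^ 0 / (L : ℝ) ^ k) ^ ((2 : ℝ) - (d + 1 : ℕ) - γ)
            * Real.exp (-(δ₀ * (tdistT (fine (L ^ k) M) (kingSlicePt L k n M x') (kingSlicePt L k n M y') / (L : ℝ) ^ 0))) ∧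
      ∀ μ : Fin (d + 1),
        |(kingSlicesTwoSpacing L k n eM M hM hk a msq).hi.dG 0 μ x' y'
            - (kingSliceKernels L k eM M hM hk a msq).dG 0 μ (kingSlicePt L k n M x') (kingSlicePt L k n M y')|
          ≤ C * (L : ℝ) ^ (-(γ * k)) * ((L : ℝ) ^ 0 / (L : ℝ) ^ k) ^ ((1 : ℝ) - (d + 1 : ℕ) - γ)
              * Real.exp (-(δ₀ * (tdistT (fine (L ^ k) M) (kingSlicePt L k n M x') (kingSlicePt L k n M y') / (L : ℝ) ^ 0))) := by
  obtain ⟨Cp, δp, hCp, hδp, Hp⟩ := kingSliceKernels_ineq363_pos (d := d) (L := L) hLodd hL ha hm0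
  obtain ⟨Cz, δz, hCz, hδz, Hz⟩ := kingSliceKernels_ineq363_zero (d := d) (L := L) hLodd hL ha hm0
  have hL0 : (0 : ℝ) < L := by exact_mod_cast Nat.pos_of_ne_zero (NeZero.ne L)
  set δ₀ : ℝ := min δp δz with hδdef
  have hδ₀ : 0 < δ₀ := lt_min hδp hδz
  set C : ℝ := Cp * Real.exp δp + Cz with hCdef
  have hC : 0 < C := by positivity
  refine ⟨C, δ₀, hC, hδ₀, ?_⟩
  intro γ k n eM hk hn M _ hM msq hmsq hcap x' y'
  have hk' : 1 ≤ k + n := one_le_add_of_one_le hk n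
  have hkL : (0 : ℝ) < (L : ℝ) ^ k := pow_pos hL0 _
  have hs : (0 : ℝ) < (L : ℝ) ^ 0 / (L : ℝ) ^ k := div_pos (pow_pos hL0 _) hkL
  set t : ℝ := tdistT (fine (L ^ k) M) (kingSlicePt L k n M x') (kingSlicePt L k n M y') with ht
  have ht0 : 0 ≤ t := tdistT_nonneg _ _ _
  -- the fine member: slice `0 + n` of the `(k+n)`-run
  obtain ⟨hp1, hp2⟩ := Hp (k + n) eM hk' M hM msq hmsq hcap (0 + n) (by omega) (by omega) x' y'
  -- the coarse member: `C^{(0),η}`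
  obtain ⟨hz1, hz2⟩ := Hz k eM hk M hM msq hmsq hcap 0 rfl (kingSlicePt L k n M x') (kingSlicePt L k n M y')
  rw [kingSliceKernels_slice, kingSliceKernels_dist, pow_div_pow_shift] at hp1 hp2
  rw [kingSliceKernels_slice, kingSliceKernels_dist, schemaWeight_eq] at hz1 hz2
  -- weights at the paired points
  have hWp : ∀ e : ℝ, Cp * ((L : ℝ) ^ 0 / (L : ℝ) ^ k) ^ e *
      Real.exp (-(δp * ((L : ℝ) ^ 0 / (L : ℝ) ^ k)⁻¹ * (tdistT (fine (L ^ (k + n)) M) x' y' / (L : ℝ) ^ (k + n))))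
        ≤ Cp * Real.exp δp * ((L : ℝ) ^ 0 / (L : ℝ) ^ k) ^ e * Real.exp (-(δ₀ * (t / (L : ℝ) ^ 0))) := by
    intro e
    have h1 := exp_hiWeight_zero_le L hδp.le k n M x' y'
    have h2 : Real.exp (-(δp * (t / (L : ℝ) ^ 0))) ≤ Real.exp (-(δ₀ * (t / (L : ℝ) ^ 0))) :=
      Real.exp_le_exp.mpr (by have := min_le_left δp δz; rw [pow_zero, div_one]; nlinarith)
    have hse : 0 ≤ Cp * ((L : ℝ) ^ 0 / (L : ℝ) ^ k) ^ e := mul_nonneg hCp.le (Real.rpow_nonneg hs.le _)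
    calc Cp * ((L : ℝ) ^ 0 / (L : ℝ) ^ k) ^ e *
          Real.exp (-(δp * ((L : ℝ) ^ 0 / (L : ℝ) ^ k)⁻¹ * (tdistT (fine (L ^ (k + n)) M) x' y' / (L : ℝ) ^ (k + n))))
        ≤ Cp * ((L : ℝ) ^ 0 / (L : ℝ) ^ k) ^ e * (Real.exp δp * Real.exp (-(δ₀ * (t / (L : ℝ) ^ 0)))) :=
          mul_le_mul_of_nonneg_left (h1.trans (mul_le_mul_of_nonneg_left h2 (Real.exp_nonneg _))) hse
      _ = Cp * Real.exp δp * ((L : ℝ) ^ 0 / (L : ℝ) ^ k) ^ e * Real.exp (-(δ₀ * (t / (L : ℝ) ^ 0))) := by ring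
  have hWz : ∀ e : ℝ, Cz * ((L : ℝ) ^ 0 / (L : ℝ) ^ k) ^ e * Real.exp (-(δz * (t / (L : ℝ) ^ 0)))
        ≤ Cz * ((L : ℝ) ^ 0 / (L : ℝ) ^ k) ^ e * Real.exp (-(δ₀ * (t / (L : ℝ) ^ 0))) := by
    intro e
    refine mul_le_mul_of_nonneg_left (Real.exp_le_exp.mpr ?_) (mul_nonneg hCz.le (Real.rpow_nonneg hs.le _))
    have := min_le_right δp δz
    rw [pow_zero, div_one]; nlinarith
  -- the rate letter is `1` at `j = 0`
  have hrate : ∀ e : ℝ, C * (L : ℝ) ^ (-(γ * k)) * ((L : ℝ) ^ 0 / (L : ℝ) ^ k) ^ (e - γ) = C * ((L : ℝ) ^ 0 / (L : ℝ) ^ k) ^ e := by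
    intro e; rw [mul_assoc, schemaRate_eq, pow_zero ((L : ℝ) ^ (-γ)), mul_one]
  refine ⟨?_, fun μ => ?_⟩
  · rw [hrate, kingSlicesTwoSpacing_hiG]
    calc |kingSliceG L (k + n) eM M hM (one_le_add_of_one_le hk n) a msq (0 + n) x' y'
            - kingSliceG L k eM M hM hk a msq 0 (kingSlicePt L k n M x') (kingSlicePt L k n M y')|
        ≤ |kingSliceG L (k + n) eM M hM (one_le_add_of_one_le hk n) a msq (0 + n) x' y'|
            + |kingSliceG L k eM M hM hk a msq 0 (kingSlicePt L k n M x') (kingSlicePt L k n M y')| := abs_sub _ _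
      _ ≤ Cp * Real.exp δp * ((L : ℝ) ^ 0 / (L : ℝ) ^ k) ^ ((2 : ℝ) - (d + 1 : ℕ)) * Real.exp (-(δ₀ * (t / (L : ℝ) ^ 0)))
            + Cz * ((L : ℝ) ^ 0 / (L : ℝ) ^ k) ^ ((2 : ℝ) - (d + 1 : ℕ)) * Real.exp (-(δ₀ * (t / (L : ℝ) ^ 0))) :=
          add_le_add (hp1.trans (hWp _)) (hz1.trans (hWz _))
      _ = C * ((L : ℝ) ^ 0 / (L : ℝ) ^ k) ^ ((2 : ℝ) - (d + 1 : ℕ)) * Real.exp (-(δ₀ * (t / (L : ℝ) ^ 0))) := by rw [hCdef]; ring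
  · rw [hrate, kingSlicesTwoSpacing_hidG]
    have hp2μ := hp2 μ
    have hz2μ := hz2 μ
    rw [kingSliceKernels_dG] at hp2μ hz2μ
    calc |(L : ℝ) ^ (k + n) * (kingSliceG L (k + n) eM M hM (one_le_add_of_one_le hk n) a msq (0 + n) (x' + unitVec (fine (L ^ (k + n)) M) μ) y'
              - kingSliceG L (k + n) eM M hM (one_le_add_of_one_le hk n) a msq (0 + n) x' y')
            - (L : ℝ) ^ k * (kingSliceG L k eM M hM hk a msq 0 (kingSlicePt L k n M x' + unitVec (fine (L ^ k) M) μ) (kingSlicePt L k n M y')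
              - kingSliceG L k eM M hM hk a msq 0 (kingSlicePt L k n M x') (kingSlicePt L k n M y'))|
        ≤ |(L : ℝ) ^ (k + n) * (kingSliceG L (k + n) eM M hM (one_le_add_of_one_le hk n) a msq (0 + n) (x' + unitVec (fine (L ^ (k + n)) M) μ) y'
              - kingSliceG L (k + n) eM M hM (one_le_add_of_one_le hk n) a msq (0 + n) x' y')|
            + |(L : ℝ) ^ k * (kingSliceG L k eM M hM hk a msq 0 (kingSlicePt L k n M x' + unitVec (fine (L ^ k) M) μ) (kingSlicePt L k n M y')
              - kingSliceG L k eM M hM hk a msq 0 (kingSlicePt L k n M x') (kingSlicePt L k n M y'))| := abs_sub _ _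
      _ ≤ Cp * Real.exp δp * ((L : ℝ) ^ 0 / (L : ℝ) ^ k) ^ ((1 : ℝ) - (d + 1 : ℕ)) * Real.exp (-(δ₀ * (t / (L : ℝ) ^ 0)))
            + Cz * ((L : ℝ) ^ 0 / (L : ℝ) ^ k) ^ ((1 : ℝ) - (d + 1 : ℕ)) * Real.exp (-(δ₀ * (t / (L : ℝ) ^ 0))) :=
          add_le_add (hp2μ.trans (hWp _)) (hz2μ.trans (hWz _))
      _ = C * ((L : ℝ) ^ 0 / (L : ℝ) ^ k) ^ ((1 : ℝ) - (d + 1 : ℕ)) * Real.exp (-(δ₀ * (t / (L : ℝ) ^ 0))) := by rw [hCdef]; ring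

end Zero

/-! ## §4 (3.73) for all slices `0 ≤ j ≤ k − 1`, in the letters of the schema -/

section All

/-- ★★ **KING's (3.73) AT `A = 0`, BOTH LINES, ALL SLICES `0 ≤ j ≤ k − 1`, IN THE LETTERS OF `SlicePropagator.Prop39PrintedAt`**: for odd `L ≥ 3`, `a > 0`,
`m₀² ≥ 0` and a rate `0 < γ < ½` there are `C, δ₀ > 0` such that for EVERY `k, n ≥ 1`, cube `2L^{e_M}`, mass `0 < m² ≤ m₀²`, the datum
`T = kingSlicesTwoSpacing L k n e_M M a m²` satisfies, for all `j + 1 ≤ k` and `x′, y′ ∈ T_{η′}`: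
`|T.hi.G j x′ y′ − T.lo.G j (T.pt x′) (T.pt y′)| ≤ C·L^{−γk}·(T.lo.slice j)^{2−D−γ}·exp(−δ₀(T.lo.slice j)^{−1}·T.lo.dist (T.pt x′) (T.pt y′))` and the gradient
line with `(T.lo.slice j)^{1−D−γ}` — the first conjunct of `Prop39PrintedAt α T C δ₀ γ` at slice `j` (§2 for `j ≥ 1`, §3 for `j = 0`).
[cite: King1986, Prop. 3.9 (3.73) p.665, (4.42)–(4.43) p.675] -/
theorem kingSlicesTwoSpacing_ineq373 (hLodd : Odd L) (hL : 2 ≤ L) {a : ℝ} (ha : 0 < a) {m0sq : ℝ} (hm0 : 0 ≤ m0sq) {γ : ℝ}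
    (hγ0 : 0 < γ) (hγ1 : γ < 1 / 2) :
    ∃ C δ₀ : ℝ, 0 < C ∧ 0 < δ₀ ∧
    ∀ (k n eM : ℕ) (hk : 1 ≤ k) (_hn : 1 ≤ n) (M : Fin (d + 1) → ℕ) [∀ μ, NeZero (M μ)] (hM : ∀ μ, M μ = 2 * L ^ eM)
      (msq : ℝ), 0 < msq → msq ≤ m0sq → ∀ j : ℕ, j + 1 ≤ (kingSlicesTwoSpacing L k n eM M hM hk a msq).lo.k →
      ∀ x' y' : Tor (fine (L ^ (k + n)) M),
      |(kingSlicesTwoSpacing L k n eM M hM hk a msq).hi.G j x' y'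
          - (kingSlicesTwoSpacing L k n eM M hM hk a msq).lo.G j ((kingSlicesTwoSpacing L k n eM M hM hk a msq).pt x')
              ((kingSlicesTwoSpacing L k n eM M hM hk a msq).pt y')|
        ≤ C * ((kingSlicesTwoSpacing L k n eM M hM hk a msq).lo.L : ℝ) ^ (-(γ * (kingSlicesTwoSpacing L k n eM M hM hk a msq).lo.k))
            * ((kingSlicesTwoSpacing L k n eM M hM hk a msq).lo.slice j) ^ ((2 : ℝ) - (d + 1 : ℕ) - γ)
            * Real.exp (-(δ₀ * ((kingSlicesTwoSpacing L k n eM M hM hk a msq).lo.slice j)⁻¹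
                * (kingSlicesTwoSpacing L k n eM M hM hk a msq).lo.dist ((kingSlicesTwoSpacing L k n eM M hM hk a msq).pt x')
                    ((kingSlicesTwoSpacing L k n eM M hM hk a msq).pt y'))) ∧
      ∀ μ : Fin (d + 1),
        |(kingSlicesTwoSpacing L k n eM M hM hk a msq).hi.dG j μ x' y'
            - (kingSlicesTwoSpacing L k n eM M hM hk a msq).lo.dG j μ ((kingSlicesTwoSpacing L k n eM M hM hk a msq).pt x')
                ((kingSlicesTwoSpacing L k n eM M hM hk a msq).pt y')|
          ≤ C * ((kingSlicesTwoSpacing L k n eM M hM hk a msq).lo.L : ℝ) ^ (-(γ * (kingSlicesTwoSpacing L k n eM M hM hk a msq).lo.k))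
              * ((kingSlicesTwoSpacing L k n eM M hM hk a msq).lo.slice j) ^ ((1 : ℝ) - (d + 1 : ℕ) - γ)
              * Real.exp (-(δ₀ * ((kingSlicesTwoSpacing L k n eM M hM hk a msq).lo.slice j)⁻¹
                  * (kingSlicesTwoSpacing L k n eM M hM hk a msq).lo.dist ((kingSlicesTwoSpacing L k n eM M hM hk a msq).pt x')
                      ((kingSlicesTwoSpacing L k n eM M hM hk a msq).pt y'))) := by
  obtain ⟨Cq, δq, hCq, hδq, Hq⟩ := kingSlicesTwoSpacing_ineq373_pos (d := d) L hLodd hL ha hm0 hγ0 hγ1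
  obtain ⟨Cz, δz, hCz, hδz, Hz⟩ := kingSlicesTwoSpacing_ineq373_zero (d := d) L hLodd hL ha hm0
  have hL0 : (0 : ℝ) < L := by exact_mod_cast Nat.pos_of_ne_zero (NeZero.ne L)
  set C : ℝ := Cq + Cz with hCdef
  set δ₀ : ℝ := min δq δz with hδdef
  have hC : 0 < C := by positivity
  have hδ₀ : 0 < δ₀ := lt_min hδq hδz
  refine ⟨C, δ₀, hC, hδ₀, ?_⟩
  intro k n eM hk hn M _ hM msq hmsq hcap j hj x' y'
  rw [kingSlicesTwoSpacing_lok] at hj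
  simp only [kingSlicesTwoSpacing_loL, kingSlicesTwoSpacing_lok, kingSlicesTwoSpacing_slice, kingSlicesTwoSpacing_lodist,
    kingSlicesTwoSpacing_pt, kingSlicesTwoSpacing_loG, kingSlicesTwoSpacing_lodG, schemaWeight_eq]
  have hR : 0 ≤ (L : ℝ) ^ (-(γ * k)) := Real.rpow_nonneg hL0.le _
  have hs : 0 < (L : ℝ) ^ j / (L : ℝ) ^ k := div_pos (pow_pos hL0 _) (pow_pos hL0 _)
  have ht : 0 ≤ tdistT (fine (L ^ k) M) (kingSlicePt L k n M x') (kingSlicePt L k n M y') / (L : ℝ) ^ j :=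
    div_nonneg (tdistT_nonneg _ _ _) (pow_pos hL0 _).le
  -- monotonicity of the display in `(C, δ₀)`
  have hmono : ∀ {Ci δi : ℝ} (e : ℝ), Ci ≤ C → δ₀ ≤ δi →
      Ci * (L : ℝ) ^ (-(γ * k)) * ((L : ℝ) ^ j / (L : ℝ) ^ k) ^ e
          * Real.exp (-(δi * (tdistT (fine (L ^ k) M) (kingSlicePt L k n M x') (kingSlicePt L k n M y') / (L : ℝ) ^ j)))
        ≤ C * (L : ℝ) ^ (-(γ * k)) * ((L : ℝ) ^ j / (L : ℝ) ^ k) ^ e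
          * Real.exp (-(δ₀ * (tdistT (fine (L ^ k) M) (kingSlicePt L k n M x') (kingSlicePt L k n M y') / (L : ℝ) ^ j))) := by
    intro Ci δi e hCi hδi
    refine mul_le_mul (mul_le_mul_of_nonneg_right (mul_le_mul_of_nonneg_right hCi hR) (Real.rpow_nonneg hs.le _))
      (Real.exp_le_exp.mpr (by nlinarith)) (Real.exp_nonneg _) (mul_nonneg (mul_nonneg hC.le hR) (Real.rpow_nonneg hs.le _))
  have hcq : Cq ≤ C := by rw [hCdef]; linarith
  have hcz : Cz ≤ C := by rw [hCdef]; linarith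
  by_cases hj1 : 1 ≤ j
  · obtain ⟨h1, h2⟩ := Hq k n eM hk hn M hM msq hmsq hcap j hj1 (by omega) x' y'
    exact ⟨h1.trans (hmono _ hcq (min_le_left _ _)), fun μ => (h2 μ).trans (hmono _ hcq (min_le_left _ _))⟩
  · obtain rfl : j = 0 := by omega
    obtain ⟨h1, h2⟩ := Hz γ k n eM hk hn M hM msq hmsq hcap x' y'
    exact ⟨h1.trans (hmono _ hcz (min_le_right _ _)), fun μ => (h2 μ).trans (hmono _ hcz (min_le_right _ _))⟩

end All

end Summit.QuantumFields.YangMills.BalabanUVNodes.N15KingModelRung.Curved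

end
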